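import Mathlib
import HarnessLib
import HarnessLib.Audit
import Summits.FinalStateConjecture.Statement
import Literature.Geometry.Lorentzian.LateTimeOmegaLimitSet

/-!
Route: BurnettKineticRigidity

DORMANT since 2026-09-04T18:32:37Z (reconciler: no traction for 5 d (last activity statement-checked at 2026-08-30T17:40:26Z); parked, not closed — `ledger route dormant route-FinalStateConjecture-BurnettKineticRigidity --off` to reacti) — unstaffed, not closed; items shared with open routes are served there. `ledger route dormant <id> --off` reactivates.

# Route BurnettKineticRigidity — undecided radiation is photons — late-time Burnett compactness +
kinetic rigidity of Einstein–massless-Vlasov, framed as censored dichotomy ∧ threshold codimension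

It suffices to show X = A ∧ B_S ∧ B_W (plus the Choquet-Bruhat–Geroch support S). A (CENSORED
DICHOTOMY, `SettlesOutsidePhotonRegions`):
every maximal vacuum Cauchy development of admissible data with complete 𝓘⁺ EITHER settles (the
conjecture's own clause as re-typed 2026-08-16, T2: exhaustive
C² decomposition into finitely many sub-extremal Kerrs moving apart plus radiation, with honest
growing near-zone radii, future-oriented chart time and every future-complete normalised null ray
from the data staying in the closure of the settled region O = J⁺(ιX) ∩ I⁻(charted)) OR carries a
PHOTON-REGION REMNANT: a late chart on a
Kerr exterior g_(M,a), 0 < M, |a| ≤ M, in which the metric converges in C² on every annular slab {t*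
= τ, ρ ≤ r ≤ R} — it is Kerr outside
a bounded radius ρ and the obstruction lives inside (this is the data-level shadow of the card
burnett-limit-photons-kinetic-rigidity:
late-time Burnett ω-limits are Einstein–massless-Vlasov, non-radiating, hence Kerr ∪
self-gravitating photon-shell configurations, and
shells sit at bounded radius; its f = 0 sector coincides with the Liouville step of the sibling card
lasalle-bondi-lyapunov-liouville, whose strong/synthetic compactness crux is NOT adopted here). B_S
(PHOTON-REGION THRESHOLD CODIMENSION,
`PhotonRegionThresholdCodim`): through every admissible datum owning a complete, remnant-carrying,
non-settling MGHD pass ONE asymptotically flat end e of X and an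
injective admissible curve, TAME on e (fixed Dafermos–Rodnianski asymptotics on that end, continuous
ADM mass M(c), weighted C²₋₁×C¹₋₂-continuous at the base datum) and immersed at c = 0 — the summit's
IsTameChristodoulouGeneric witness shape, which admits no far-out burial families — all of whose
other members have only complete MGHDs on which remnant ⇒ settles. B_W (CENSORSHIP-VIOLATION
CODIMENSION, `CensorshipViolationCodim`): the same escape through every admissible datum owning an
MGHD with incomplete 𝓘⁺.
S (`MGHDExistence`): admissible data have an MGHD. Then A, B_S, B_W, S ⊢ FinalStateConjecture by
classical logic (the deciding theorem
`closes`, proved sorry-free in Sketch.lean/glue.lean): an exceptional datum is, by S and A, either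
censorship-violating or
photon-region-threshold, and B_W / B_S supply the end and the tame Christodoulou curve, whose other
members satisfy the conjecture's property by A again.
Lean: `SettlesOutsidePhotonRegions ∧ PhotonRegionThresholdCodim ∧ CensorshipViolationCodim ∧
MGHDExistence`

## Assembly
Classical logic, proved sorry-free (`closes` in glue.lean, checked with `lean check`): fix X and an
admissible d failing the conjecture's
property P. By MGHDExistence an MGHD exists, so some MGHD 𝒟 of d is incomplete or
complete-and-non-settling. If incomplete,
CensorshipViolationCodim gives the end e and the tame immersed curve F. Otherwise every MGHD is
complete, SettlesOutsidePhotonRegions gives a remnant on 𝒟, and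
PhotonRegionThresholdCodim gives F. For c ≠ 0, F c is admissible, has an MGHD (MGHDExistence), every
MGHD is complete with
remnant ⇒ settles (escape clause) and settles ∨ remnant (SettlesOutsidePhotonRegions), hence
settles: P (F c). So {d ∈ 𝓓 | ¬P d} has
TAME codimension ≥ 1 in 𝓓, i.e. FinalStateConjecture.

Rationale: WHY THIS LINE. Pass to the limit object in the weakest topology in which "vacuum" survives: by
Burnett's conjecture — now a theorem for smooth limits
without symmetry in generalised wave coordinates (Huneau–Luk arXiv:2403.03470; U(1):
arXiv:1907.10743; converse for null dusts: Touati
arXiv:2402.17530) — C⁰/W^{1,∞}-weak-* limits of vacuum metrics are Einstein–MASSLESS-Vlasov, the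
Vlasov measure being exactly the
gravitational radiation that has neither reached 𝓘⁺ nor crossed 𝓗⁺; LaSalle with the Bondi mass
makes every late-time ω-limit
non-radiating with bi-trapped Vlasov support, so the final-state problem becomes a KINETIC RIGIDITY
problem (classify non-radiating AF
Einstein–massless-Vlasov black-hole exteriors: Kerr with f = 0, or photon shells — Andréasson
arXiv:2102.08170, AFT arXiv:1511.01290),
and "Kerr cannot hold photons" (transport decay on Kerr, arXiv:1612.09304, arXiv:2501.09730)
replaces the linear spectral industry
near Kerr, while the price — photon-shell and extremal thresholds — is paid in the currency the
conjecture concedes, Christodoulou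
codimension (KehleUnger2025 for the extremal threshold). Imported areas: homogenisation /
compensated compactness (Burnett–Huneau–Luk),
kinetic theory (Vlasov rigidity and decay), topological dynamics (ω-limit sets, LaSalle), the
Duyckaerts–Kenig–Merle resolution template
(profile ↦ Burnett limit, soliton ↦ Kerr, radiation ↦ Vlasov measure, channel-of-energy rigidity ↦
kinetic rigidity). What the line adds
to the nearest prior art (Lott arXiv:1709.03952 rescaled future limits with backreaction;
Sakovich–Sormani arXiv:2410.16800 §6.7 weak
no-hair via intrinsic-flat limits) is the Vlasov enlargement of the limit category and the typed,
non-circular genericity frame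
(A: failure of settling with complete 𝓘⁺ is confined to photon regions; B: such thresholds and
censorship violations have codimension ≥ 1),
which no FSC route had (first route of the summit; negatives index empty). Re-type T2 of the summit
(2026-08-16, p126844) is threaded through the frame, not added beside it: A asserts the summit's
settles clause verbatim (RaysStayInClosure, honest-radii HasExhaustiveCharts, IsFutureOriented —
properties of the physical late-time picture A claims), and B_S/B_W produce the summit's TAME
witness (one fixed end, continuous mass, immersed at 0), which removes the far-out burial shortcut
the route review (N2) had found in the old IsSmoothDataFamily form and returns B_S/B_W to genuine
threshold transversality / naked-singularity instability at fixed asymptotics.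

RANKED CRUXES. #2 SettlesOutsidePhotonRegions (crux) — CENSORED DICHOTOMY (card H1+H2+H3+H5 at data
level): for every admissible datum D and every maximal vacuum Cauchy development 𝒟 of D with
complete future null infinity, either 𝒟 settles in the summit's (re-typed) sense (∃ O, ∃ d :
FinalStateDecomposition 𝒟 O 2 with all
final holes sub-extremal, O = J⁺(ιX) ∩ I⁻(charted), RaysStayInClosure 𝒟 O, HasExhaustiveCharts d
with honest growing radii, IsFutureOriented d), or 𝒟 carries a
photon-region remnant: ∃ 0 < M, |a| ≤ M, ρ, τ₀ and a late chart Ψ on the Kerr background (M, a) into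
J⁺(ιX) (IsLateChart) such that for every R the C² sup-norm of Ψ^*g − g_(M,a) on the annular slab {t*
= τ, ρ ≤ r ≤ R} tends to 0 as τ → ∞. [difficulty: open-problem] (why it might fail: A censored
development with NO asymptotically-Kerr world-tube at any radius: eternal bound or whirling
binaries, floating orbits, time-periodic vacuum hair, drifting parameters (M(τ), a(τ) not converging
on the annuli), or final Bondi mass 0 without C² dispersal; a non-spherical kinetic remnant is not
EXACTLY Kerr on the annuli (route review N1); a settled MGHD hiding a future-complete null ray in
its interior breaks RaysStayInClosure.) [arXiv:1907.10743, arXiv:2403.03470,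
arXiv:1709.03952, arXiv:2410.16800, arXiv:1612.09304, DafermosLuk2017, KlainermanSzeftel2023]
#3 PhotonRegionThresholdCodim (crux) — PHOTON-REGION THRESHOLD CODIMENSION (card H4, where the
novelty audit put all the weight; includes the extremal threshold |a| = M): for every admissible
datum D possessing an MGHD 𝒟 which has complete 𝓘⁺, carries a photon-region remnant (as in
SettlesOutsidePhotonRegions) and does NOT settle, there are ONE asymptotically flat end e of X and
an injective one-parameter
family F : ℝ¹ → data of admissible data, F 0 = D, TAME on e (IsTameDataFamily: jointly smooth, every
member (1 + 2M(c)/r)δ + o₂(r⁻¹), o₁(r⁻²) on e with M(c) continuous, e.wDist (F c) (F 0) → 0 as c →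
0) and immersed at c = 0 (IsImmersedAtZero), such that for every c ≠ 0 every MGHD of F c has
complete 𝓘⁺ and settles whenever it carries a remnant (escape from the threshold INTO the good set;
Christodoulou codimension ≥ 1 of the shell/extremal threshold). [deps: SettlesOutsidePhotonRegions]
[difficulty: open-problem] (why it might fail: Photon-shell or extremal thresholds may be
one-sidedly STABLE along every admissible curve (no transversal shell-energy direction inside the
vacuum constraint class), or the escaping curve may land on censorship-violating or other threshold
data; tameness forbids escaping by far-out burial, so the transversal direction must exist at fixed
asymptotics.) [arXiv:2102.08170, arXiv:1511.01290, KehleUnger2025, Aretakis2015, Christodoulou1999,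
arXiv:2501.09730]
#4 CensorshipViolationCodim (crux) — CENSORSHIP-VIOLATION CODIMENSION (weak cosmic censorship in
Christodoulou's positive-codimension form, with escape into the good set): for every admissible
datum D possessing an MGHD with INCOMPLETE future null infinity there are one asymptotically flat
end e of X and an injective
one-parameter family of admissible data through D, tame on e and immersed at 0, all of whose other
members have only MGHDs with
complete 𝓘⁺ on which remnant ⇒ settles. [difficulty: open-problem] (why it might fail: WCC itself:
the vacuum naked singularities of RodnianskiShlapentokhRothman2023 may be stable under smooth
admissible perturbations (blue-shift instability absent for regular perturbations, Singh); and the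
escape must avoid every threshold, not only incompleteness.) [Christodoulou1999,
Christodoulou1999instability, RodnianskiShlapentokhRothman2023, DafermosRodnianski2008,
Christodoulou2008]
#9 MGHDExistence (crux since 2026-08-16 rev 8–9: the summit-wide SHARED item
stmt-FinalStateConjecture-9937, a hypothesis of the crux-only `closes`; typing-exposed and an
unproved XL tree fact) — Choquet-Bruhat–Geroch over the repaired development structure,
restricted to the admissible class: every admissible vacuum datum has a maximal vacuum Cauchy
development (VacuumCauchyDevelopment, IsMaximal). The prelude deliberately does not yet declare this
named fact (CauchyProblemCauchy.lean, D-0026); it is the anti-vacuity conjunct of the Statement and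
is consumed by `closes`. [difficulty: XL] [ChoquetBruhatGeroch1969CMP, Ringstrom2009,
Sbierski2016AHP] #5 KineticRigidityEMV (crux, informal; unchanged) — classify non-radiating AF
Einstein–massless-Vlasov black-hole exteriors with bi-trapped Vlasov support: Kerr with f = 0 or
photon-shell configurations at bounded radius. #6 LateTimeBurnettIdentification (crux; REPAIRED
restatement 2026-08-16 of LateTimeBurnettCompactness, which refuter rattack-9999 classed misstated
at the informal level — Minkowski witnesses W1 (time relabelling t' = t log t: all C¹ bounds hold,
limits degenerate) and W2 (WKB gauge noise: bounded H, unbounded ∂H, HL measure negative) against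
the bare hypothesis list IsLateChart + C¹ bounds) — now TYPED and LOCAL: a smooth time-oriented
vacuum spacetime, a smooth chart of the Kerr–Schild domain with (H0) uniform C¹ bounds of the
translates on the slabs, (T1) uniform non-degeneracy √|det| ≥ Λ⁻¹ ∧ g^{00} ≤ −Λ⁻¹ (chart time a
uniformly timelike covector; Kerr–Schild charts across ergoregion and horizon admissible), (T2)
sup(|H| + |∂H|) ≤ C for the contracted Christoffels H^α = g^{μν}Γ^α_{μν} (HL (1.3)–(1.4)) ⇒ every
Burnett limit g_∞ of translates g_{T_n}, T_n → ∞, on a slab carries, along a subsequence, a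
non-negative defect-measure datum μ_∞ (HL Def. 4.1 with (1.5)) with (1) null support, (2) the
DISTRIBUTIONAL Einstein equation Ric(g_∞) dVol = ∫ ω⊗ω dμ_∞ (weak Ricci of the Lipschitz,
Geroch–Traschen-regular limit), (3) μ_∞ ≥ 0 by type, (4) HL's Poisson-bracket Vlasov equation (1.6)
whenever g_∞ ∈ C¹ (for merely Lipschitz limits transport is not asserted: no published definition).
(why it might fail: HL Thm 1.5 needs C^∞ limits, bounded U, a frequency scale |∂²g_n| ≲ λ_n⁻¹ — (4)
without it is avowedly open, Rem. 1.3 — and a gauge RATE |H_n − H₀| ≲ λ_n^η; here Lipschitz limits,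
no scale, H converging without rate, unbounded slabs.) [arXiv:2403.03470, arXiv:1907.10743,
arXiv:2404.07659, Burnett1989, doi:10.1103/PhysRevD.36.1017, arXiv:0712.0122] #7
OmegaLimitsNonRadiating (crux, informal; the LaSalle leg (b) of the old item with the refuter's
scope/bookkeeping repairs: T4 late EMBEDDING of the self-determined exterior O = J⁺(ιX) ∩ I⁻(Ψ{t* >
τ₀}) instead of a mere late chart, T5 fixed slab length L, 'non-radiating' in FLUX form for the
limit class, horizon side via Hawking area not Bondi mass) — every ω-limit with defect datum has
vanishing outgoing (R → ∞) and ingoing flux; needs the definition NonRadiatingBurnettLimit. (why it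
might fail: lower semicontinuity of the Bondi-type flux at Lipschitz regularity; with asymptotically
flat t*-slices radiation recedes to r = ∞ inside every slab, so the limit's flux is lim_R lim_n and
may exceed what 𝓘⁺ accounts for; gauge/BMS normalisation; one Kerr-exterior-shaped chart cannot be a
late embedding when N ≥ 2.) [arXiv:1709.03952, DafermosRodnianski2008, Hale1980,
doi:10.1007/PL00001029] #9 LateTimeBurnettPrecompactness (support; the Arzelà–Ascoli half of the old
item, typed) — C¹ components and uniform C¹ bounds of the translates ⇒ every T_n → ∞ has a
subsequence Burnett-converging on the slab (so the late-time Burnett ω-limit set is nonempty; Sketch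
example proved). Leg (c) of the old item (ω-limit set compact, connected, translation invariant) is
Hale bookkeeping and is not filed.

TWO-LAYER PLAN. Foreseen glued splits (filed only after a crux closes or the requested definitions
land): SettlesOutsidePhotonRegions ⇐ [H1, NOT YET AN ITEM: every censored MGHD of admissible data
carries a late EMBEDDING of its exterior on a Kerr–Schild domain with the bounds H0 + T1 + T2 — the
a-priori Huneau–Luk bounds, flagged by the route reviews rreview-g2 / g44-27 as nobody's conclusion;
the tenure planner files it as its own ranked crux (with or above #6) together with the glue for A]
+ LateTimeBurnettPrecompactness (support: ω-limits exist) + LateTimeBurnettIdentification (#6: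
ω-limits are weak Einstein–massless-Vlasov) + OmegaLimitsNonRadiating (#7: ω-limits are
non-radiating, Vlasov flux trapped) → KineticRigidityEMV (#5: non-radiating AF EMV exteriors are
Kerr with f = 0 or photon-shell configurations at bounded radius) → BurnettToC2Upgrade
(Burnett-close to Kerr on long slabs + vacuum ⇒ C²-close after a fixed time; then Klainerman–Szeftel
/ the sub-extremal stability conjecture gives the exhaustive decomposition; N ≥ 2 by kinematic
separation) → SettlesOutsidePhotonRegions. The 2026-08-16 repair (this revision) split the old
LateTimeBurnettCompactness into #6 (typed), #7 (informal) and the support item, after the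
definitions BurnettConvergence / BurnettDefectMeasure / EinsteinMasslessVlasov /
LateTimeOmegaLimitSet landed; KineticRigidityEMV stays informal (EinsteinMasslessVlasov is typed for
C² metrics only; IPlusRegular has landed).
PhotonRegionThresholdCodim ⇐ ShellEnergyTransversality
(one-parameter admissible families changing the trapped high-frequency energy, via
Corvino–Schoen/Carlotto–Schoen gluing inside the
constraint class) → ExtremalThresholdTransversality (Kehle–Unger third-law families) → glue.
CensorshipViolationCodim ⇐ vacuum
naked-singularity instability (trapped-surface formation under a generic smooth perturbation,
Christodoulou/An) → landing in the good set
(uses SettlesOutsidePhotonRegions) → glue.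

KILL CRITERIA. A censored admissible development (complete 𝓘⁺) admitting neither an exhaustive
sub-extremal decomposition nor an asymptotically-Kerr
annular world-tube refutes SettlesOutsidePhotonRegions and closes the route (`close --reason
refuted:SettlesOutsidePhotonRegions`): the
compactness-plus-rigidity picture is then wrong, not merely unproved. An OPEN set of
photon-region-threshold data (nonlinearly stable
self-gravitating photon shells reachable from vacuum, or stable extremal formation) refutes
PhotonRegionThresholdCodim and the conjecture
as formalised — close `refuted:PhotonRegionThresholdCodim` and hand the witness to the negatives
index. ¬CensorshipViolationCodim is ¬WCC
in codimension form and kills every FSC route. Pivot, not kill: if KineticRigidityEMV fails through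
rotating or time-periodic photon
configurations, the threshold set of B_S is enlarged and the typed frame stands. A proof of FSC
elsewhere moots the route; a proof of
sub-extremal Kerr stability does not (it is the upgrade child of A).

NOT DECOMPOSED YET. The upgrade lemma (weak-to-C² near Kerr: frequency-independent leakage of
trapped high-frequency energy, Morawetz with log-loss), the
N ≥ 2 kinematics (Poincaré motions versus parabolic escape thresholds), the gauge normalisation of
ω-limits (BMS at 𝓘⁺, horizon
normalisation), convergence of the annulus parameters (M(τ), a(τ)) from Bondi-mass monotonicity and
angular-momentum flux, the
I⁺-regularity of limits needed by the f = 0 rigidity, the a-priori Huneau–Luk bounds themselves (the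
conditional input H1 of the card,
which the 2026-08-16 repair makes the explicit hypotheses H0 + T1 + T2 of
LateTimeBurnettIdentification / OmegaLimitsNonRadiating and which must become the separate crux H1
of the TWO-LAYER PLAN), and every constant
— all layer-2 material.

CHEAPEST FALSIFIER. One lookup/computation: are Andréasson's static massless-Vlasov shells around
Schwarzschild (arXiv:2102.08170, existence Thm. 1 and
the numerics of its last section) available at ARBITRARILY SMALL shell mass ε → 0 near r = 3M, and
are they linearly unstable with a
one-dimensional unstable manifold? "Small-mass shells exist and are codimension-1 unstable" is
exactly what B_S bets on; "small-mass shells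
exist and are STABLE in an open set of EMV data" kills the line (kill criterion 2) provided such
configurations are Burnett limits of
vacuum (Touati's reverse-Burnett construction arXiv:2402.17530 for null dusts is the tool to test
reachability). I could not run it: the
remote literature cascade was rate-limited/unavailable during this session (searchd rc 75;
arXiv/OpenAlex/S2 HTTP 429); zbMATH and galaxy
answered (see Novelty).

NUMBERS. Schwarzschild photon sphere r = 3M, null-geodesic Lyapunov exponent 1/(3√3 M) per unit
static time (frequency-independent leakage); Kerr
photon region r ∈ [2M(1 + cos(⅔ arccos(−|a|/M))), 2M(1 + cos(⅔ arccos(|a|/M)))]; static Vlasov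
shells obey 2m/r < 8/9 (Andréasson's
Buchdahl bound) and AFT massless shells are highly relativistic; Huneau–Luk 2024 hypotheses: |g_n −
g₀| ≤ λ_n, |∂g_n| ≲ 1, |∂²g_n| ≲ λ_n⁻¹,
wave-coordinate defect ≲ λ_n^η, g₀ smooth, bounded domain (arXiv:2403.03470 Assumptions 1.2);
nonlinear Kerr stability printed only for
|a|/M ≪ 1 (KlainermanSzeftel2023, GiorgiKlainermanSzeftel2022) and Schwarzschild in codimension 3
(DHRT arXiv:2104.08222). Items at open: 5
typed (3 cruxes, 1 support, 1 assembly) + 2 informal cruxes and 4 definition requests filed right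
after open. Route-repair 2026-08-16 (statement re-type T2): the three typed cruxes restated 1:1
under the same decl names; `closes` re-elaborated (rc 0, axioms
propext/Classical.choice/Quot.sound).
Route-repair 2026-08-16 (glue, rev 7–9): the stale fullbuild stamp (build synced before rev 6)
cleared by re-certifying `closes`; `closes` made CRUX-ONLY (idle `_hAsm : Assembly` dropped;
MGHDExistence restated δ-identically onto the shared crux stmt-FinalStateConjecture-9937 and
re-badged crux rank 9): items now 5 cruxes (#2 #3 #4 typed + #6 LateTimeBurnettIdentification +
#9 MGHDExistence), 3 supports (LateTimeBurnettPrecompactness PROVED, KineticRigidityEMV and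
OmegaLimitsNonRadiating informal), 1 assembly. Import cone: the unproved Riemannian facts
buchner1977_cutLocus_triangulable / ricciFlow_curvature_blowup enter only via
LateTimeOmegaLimitSet → BoundedGeometry (needs-fact: NONE; import-split request defn-ChartMetric
filed).

DEFINITION REQUESTS. LANDED (2026-08-15/16): (1) BurnettConvergence + BurnettDefectMeasure
(Literature/Geometry/Lorentzian: BurnettConverges, BurnettConvergesAtScale, WaveCoordinateCondition,
MetricCoord.waveGauge; IsBurnettDefectDatum = HL Def. 4.1 with (1.5) in consequence form,
cosphereSecondMoment); (2) EinsteinMasslessVlasov (manifold level, measure solutions à la HL Def.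
2.1/2.3 — C¹/C² metrics only, hence NOT usable for Lipschitz chart-level Burnett limits: #6 types
the weak system inline at chart level instead); (3) LateTimeOmegaLimitSet
(lateTimeBurnettOmegaLimitSet, lateTimeBurnettDefectOmegaLimitSet, translatedChartMetric,
HasUniformBurnettBounds); (4) IPlusRegular (IsIPlusRegular). NEW (filed with this repair): (5)
NonRadiatingBurnettLimit (Summits/FinalStateConjecture/FinalStateConjecture/Theorems, new object):
for a chart-level Lipschitz pair (g_∞, μ_∞) on a Kerr–Schild slab S_L — the outgoing energy flux
through {r = R} ∩ S_L (μ_∞-momentum flux + Bondi-type shear flux of g_∞) → 0 as R → ∞ and vanishing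
ingoing flux at the inner end (area/expansion form), wanted by OmegaLimitsNonRadiating (#7). NOT
filed: measure transport (Vlasov) on Lipschitz metrics (would upgrade clause (4) of #6; no source —
HL Def. 2.1 is C¹). Informal cruxes standing: KineticRigidityEMV (#5), OmegaLimitsNonRadiating (#7).

Novelty: Searches (2026-08-15): `lit search "Burnett conjecture … massless Vlasov"` ×3 → searchd unavailable
(rc 75); `--source arxiv|openalex|s2` →
HTTP 429 (rate-limited); `--source zbmath "Burnett conjecture Einstein vacuum Vlasov
high-frequency"` → 2 (arXiv:1907.10743, arXiv:2107.00942);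
`--source zbmath "au:Huneau au:Luk"` → 6 (incl. arXiv:2403.03470 Burnett's conjecture in generalized
wave coordinates 2024 — READ pp. 1–3:
identification without symmetry for SMOOTH limits on bounded domains; arXiv:2404.07659;
arXiv:2506.21779); `lit galaxy search "Burnett's
conjecture" --star all/pdf` → 1 (pdf:-1449080005443730060 = arXiv:1907.10743); `lit galaxy search
"photon shells" --star pdf` → 1 unrelated
(Minkowski stability with massless Vlasov, Chalmers); `ledger negatives --problem
FinalStateConjecture` → 0; plus the card's two refuter
novelty audits (zbMATH/S2/galaxy; Huneau–Luk survey pp. 6, 31 and Sakovich–Sormani §6.7 read by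
them).
Nearest prior art found: arXiv:1709.03952 (Lott 2018: rescaled future limits of vacuum/CMC
spacetimes with backreaction — the mechanism in
cosmology, C⁰ limits with non-traceless effective matter); arXiv:2410.16800 §6.7 Conj. 6.37, Rem.
6.33, 6.47–6.48 (Sakovich–Sormani: FSC as
weak no-hair via intrinsic-flat limits, flags that weak limits of vacuum satisfy other matter
models); arXiv:2403.03470 / arXiv:1907.10743
(Huneau–Luk: local-in-time identification of Burnett limits as Einstein–massless-Vlasov);
arXiv:2102.08170 (Andréasson: static massless
Vlasov  [refs: 1907.10743, 2107.00942, 2403.03470, 2404.07659, 2506.21779, 1709.03952, 2410.16800, 2102.08170]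

Barriers (technique_class: weak-compactness, kinetic-rigidity, codim-genericity): - technique_class: weak-compactness, kinetic-rigidity, codim-genericity
- Literature.Barriers.FinalStateConjecture.SbierskiTrappingObstruction: trapping is used, not fought
— the rigidity/upgrade legs rest on the normally hyperbolic (unstable) character of Kerr trapping
and on transport decay for Vlasov (degenerate-at-trapping statements the barrier permits); no
loss-free LED is ever claimed.
- Literature.Barriers.FinalStateConjecture.PriceLawTail: no decay RATE appears in any item
(LaSalle/ω-limit statements are qualitative; A asks only Tendsto … (𝓝 0)); tails are part of what
converges weakly.
- Literature.Barriers.FinalStateConjecture.HairyKerrBifurcation: matter-sensitive in the right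
direction — the Burnett closure of VACUUM contains only MASSLESS Vlasov (null momenta), so
Klein–Gordon hair (massive, timelike frequencies, Chodosh–Shlapentokh-Rothman) is outside the limit
category; KineticRigidityEMV uses Ric = T[f massless] exactly.
- Literature.Barriers.FinalStateConjecture.KerrLinearHair: same evasion — no massive or
time-periodic linear field is a Burnett limit of vacuum; the route's 'hair' candidates are photon
shells, placed in the threshold set of B_S rather than denied.
- Literature.Barriers.FinalStateConjecture.KleinGordonSuperradiantInstability: no Klein–Gordon mass;
massless Vlasov on Kerr has pointwise non-negative energy density for every observer and no
superradiant amplification of particle number.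
- Literature.Barriers.FinalStateConjecture.KerrSuperradianc

Novelty grade: new-combination — ROUTE REVIEW (refuter rreview-0815T14-14) VERDICT ok; grade mirrors card audits. CHECKS: route module 'unbuilt' on the check farm all session (rc75) but the gate's native closes-check passed at open and all 4 typed decl BODIES elaborate rc0 as examples over Statement (W3b.lean); 5 typed items stampe (refuter refuter-rreview-0815T14-14-0, 2026-08-15T15:26:52Z; prior: arXiv:1709.03952 (Lott 2018); arXiv:2410.16800 sec 6.7 (Sakovich-Sormani); arXiv:2403.03470, arXiv:1907.10743 (Huneau-Luk); arXiv:2102.08170, arXiv:1511.01290 (photon shells); arXiv:1612.09304)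

History (route lifecycle, newest last):
- 2026-08-16T02:18:49Z · AUTO-CRUX: 1 conjecture-grade item(s) promoted to crux (LateTimeBurnettCompactness) — refuter vetting / tiering apply (operator:999:1362873)
- 2026-08-16T03:09:43Z · rev 5: restated LateTimeBurnettCompactness (stmt-FinalStateConjecture-9999) — repair: LateTimeBurnettCompactness refuted-misstated at the informal level by refuter rattack-9999 (Minkowski witnesses W1 time relabelling t'=t log t, W2 WKB g (planner-rrefute-FinalStateConjecture-BurnettKi-103b3b93-0)
- 2026-08-16T03:20:07Z · rev 5: restated LateTimeBurnettIdentification (stmt-FinalStateConjecture-14235) — repair pass 2 (same decl LateTimeBurnettIdentification): T1 corrected from the cone form (∂₀ uniformly timelike + slices uniformly spacelike), which wrongly EXC (planner-rrefute-FinalStateConjecture-BurnettKi-103b3b93-0)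
- 2026-08-16T23:13:53Z · rev 6: restated SettlesOutsidePhotonRegions (stmt-FinalStateConjecture-9987), PhotonRegionThresholdCodim (stmt-FinalStateConjecture-9988), CensorshipViolationCodim (stmt-FinalStateConjecture-9989) — route-repair (statement-revised p126844, re-type T2): restated SettlesOutsidePhotonRegions / PhotonRegionThresholdCodim / (planner-rrepair-FinalStateConjecture-BurnettKi-3e400391-0)
- 2026-08-16T23:49:46Z · rev 8: restated MGHDExistence (stmt-FinalStateConjecture-9990) — route-repair (glue.non-crux-hypothesis): closes is now CRUX-ONLY — idle hypothesis _hAsm : Assembly dropped; MGHDExistence (was support stmt-9990) restated 1:1 (planner-rbadge-FinalStateConjecture-BurnettKin-eda767bc-0)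
- 2026-08-24T05:54:05Z · DORMANT — reconciler: no traction for 6.6 d (last activity item-evidence-added at 2026-08-17T15:45:33Z); parked, not closed — `ledger route dormant route-FinalStateConjec (operator:999:3496780)
- 2026-08-30T17:05:36Z · REACTIVATED (open) — reconciler: reactivated — activity statement-checked at 2026-08-30T15:54:01Z after parking at 2026-08-24T05:54:05Z (operator:999:384662)
- 2026-09-04T18:32:37Z · DORMANT — reconciler: no traction for 5 d (last activity statement-checked at 2026-08-30T17:40:26Z); parked, not closed — `ledger route dormant route-FinalStateConjecture (operator:999:2115945)

sub-problem: FinalStateConjecture · status: dormant · opened planner-plancard-FinalStateConjecture-FinalSt-b2a90f2f-0 2026-08-15T14:59:08Z · rev 10 · ledger route-FinalStateConjecture-BurnettKineticRigidity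
GENERATED by the gate from the ledger (D-0016/17). Provers cite these decls: `theorem foo : Summit.FinalStateConjecture.FinalStateConjecture.Theses.BurnettKineticRigidity.<Decl> := …` in Summits/FinalStateConjecture/FinalStateConjecture/Theorems/<Name>.lean.
-/

namespace Summit.FinalStateConjecture.FinalStateConjecture.Theses.BurnettKineticRigidity

open scoped BigOperators Topology Manifold Classical MeasureTheory ProbabilityTheory Matrix InnerProductSpace ComplexConjugate ContinuousMap ContDiff
open Filter Set Function TopologicalSpace MeasureTheory

attribute [summit_statement] _root_.FinalStateConjecture

-- earlier SettlesOutsidePhotonRegions (stmt-FinalStateConjecture-9987, replaced 2026-08-16T23:13:53Z -> stmt-FinalStateConjecture-17292): retired by None — ∀ (X : Type) [TopologicalSpace X] [ChartedSpace Literature.Geometry.Lorentzian.E3 X] [IsManifold (𝓡 3) ∞ X] [T2Space X] [SecondCountableTopology X] [ConnectedSpace X], ∀ D ∈ Literature.Geometry.Lorentzian.admissibleVacuumData X, ∀ 𝒟 : Literature.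
/-- item stmt-FinalStateConjecture-17292 · crux · rank 2 · open · by planner
why it might fail: Remnant pins EXACT Kerr on all annuli (no Birkhoff beyond spherical symmetry: a rotating kinetic remnant, cf. arXiv:2202.10245, has non-Kerr multipoles at every radius; drifting (M(τ),a(τ))); and RaysStayInClosure fails if a settled MGHD hides a future-COMPLETE null ray in its interior.
sources: arXiv:2202.10245, arXiv:1504.04592, arXiv:1003.3402, arXiv:2403.03470, arXiv:1907.10743, arXiv:1709.03952
[crux] CENSORED DICHOTOMY (card H1+H2+H3+H5 at data level; re-typed with the summit 2026-08-16, T2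
p126844): for every admissible datum D and every maximal vacuum Cauchy development 𝒟 of D with
complete future null infinity, either 𝒟 SETTLES in the summit's sense (∃ O, ∃ d :
FinalStateDecomposition 𝒟 O 2 with all final holes sub-extremal, O = J⁺(ιX) ∩ I⁻(charted), every
future-complete normalised null ray from the data staying in closure O (RaysStayInClosure),
HasExhaustiveCharts d with honest growing near-zone radii Rᵢ(τ) ≥ max(r₊,0)+1, Rᵢ → ∞, and
future-oriented chart time (IsFutureOriented: orthochronous motions, transported Kerr time vector /
∂₀ eventually future-directed on the certified slabs)), or 𝒟 carries a photon-region remnant: ∃ 0 <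
M, |a| ≤ M, ρ, τ₀ and a late chart Ψ on the Kerr background (M, a) into J⁺(ιX) (IsLateChart) such
that for every R the C² sup-norm of Ψ^*g − g_(M,a) on the annular slab {t* = τ, ρ ≤ r ≤ R} tends to
0 as τ → ∞. The three new conjuncts are properties of the physical late-time picture this disjunct
asserts (horizon-normalised future-directed charts with growing near zones; O ⊇ every complete null
ray up to closure), hence threaded into A rathe -/
@[route_item "route-FinalStateConjecture-BurnettKineticRigidity"]
def SettlesOutsidePhotonRegions : Prop :=
  ∀ (X : Type) [TopologicalSpace X] [ChartedSpace Literature.Geometry.Lorentzian.E3 X] [IsManifold (𝓡 3) ∞ X] [T2Space X] [SecondCountableTopology X] [ConnectedSpace X], ∀ D ∈ Literature.Geometry.Lorentzian.admissibleVacuumData X, ∀ 𝒟 : Literature.Geometry.Lorentzian.VacuumCauchyDevelopment D, 𝒟.IsMaximal → Summit.FinalStateConjecture.HasCompleteNullInfinity 𝒟.toCauchyDevelopment → (∃ (O : Set 𝒟.carrier) (d : Literature.Geometry.Lorentzian.FinalStateDecomposition 𝒟.toSpacetime O 2), (∀ i, Literature.Geometry.Lorentzian.Kerr.IsSubextremal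 (d.mass i) (d.spin i)) ∧ O = Summit.FinalStateConjecture.exteriorOf 𝒟.toCauchyDevelopment d.charted ∧ Summit.FinalStateConjecture.RaysStayInClosure 𝒟.toCauchyDevelopment O ∧ Summit.FinalStateConjecture.HasExhaustiveCharts d ∧ Summit.FinalStateConjecture.IsFutureOriented d) ∨ (∃ (M a ρ τ₀ : ℝ) (Ψ : ↥(Literature.Geometry.Lorentzian.Kerr.background M a).domain → 𝒟.carrier), 0 < M ∧ |a| ≤ M ∧ 𝒟.toSpacetime.IsLateChart (Literature.Geometry.Lorentzian.Kerr.background M a) (𝒟.metric.causalFuture 𝒟.timeOrientation (Set.range 𝒟.embed)) τ₀ Ψ ∧ ∀ R : ℝ, Filter.Tendsto (fun τ : ℝ ↦ Literature.Geometry.Lorentzian.supCkENorm (Subtype.val '' {x : ↥(Literature.Geometry.Lorentzian.Kerr.background M a).domain | (x : Literature.Geometry.Lorentzian.E4) 0 = τ ∧ ρ ≤ Literature.Geometry.Lorentzian.Kerr.radius a x ∧ Literature.Geometry.Lorentzian.Kerr.radius a x ≤ R}) 2 (𝒟.toSpacetime.deviationExtend (Literature.Geometry.Lorentzian.Kerr.background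 M a) Ψ)) Filter.atTop (nhds 0))

-- earlier PhotonRegionThresholdCodim (stmt-FinalStateConjecture-9988, replaced 2026-08-16T23:13:53Z -> stmt-FinalStateConjecture-17293): retired by None — ∀ (X : Type) [TopologicalSpace X] [ChartedSpace Literature.Geometry.Lorentzian.E3 X] [IsManifold (𝓡 3) ∞ X] [T2Space X] [SecondCountableTopology X] [ConnectedSpace X], ∀ D ∈ Literature.Geometry.Lorentzian.admissibleVacuumData X, (∃ 𝒟 : Literature.
/-- item stmt-FinalStateConjecture-17293 · crux · rank 3 · open · by planner
why it might fail: Curve codimension can fail for thresholds with empty interior (Dafermos 2025 §6.4: chaotic fractional-codim extremal-forming residue met by every curve); static massless shells are codim-1 only numerically, in symmetry; tameness (fixed end, M(c) continuous) forbids the far-out burial escape.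
sources: doi:10.1007/s10714-025-03394-1, arXiv:2402.10190, arXiv:1409.5176, arXiv:2102.08170, arXiv:1511.01290, KehleUnger2025
[crux] PHOTON-REGION THRESHOLD CODIMENSION, TAME FORM (card H4, where the novelty audit put all the
weight; includes the extremal threshold |a| = M; re-typed with the summit 2026-08-16, T2 p126844):
for every admissible datum D possessing an MGHD 𝒟 which has complete 𝓘⁺, carries a photon-region
remnant (as in SettlesOutsidePhotonRegions) and does NOT settle in the summit's sense (sub-extremal
exhaustive decomposition with RaysStayInClosure, honest radii, IsFutureOriented), there are ONE
asymptotically flat end e of X and an injective one-parameter family F : ℝ¹ → data of admissible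
data, F 0 = D, TAME on e (IsTameDataFamily: jointly smooth; e the sole end; every member (1 +
2M(c)/r)δ + o₂(r⁻¹), o₁(r⁻²) on e with M(c) continuous; e.wDist (F c) (F 0) → 0 as c → 0) and
immersed at c = 0 (IsImmersedAtZero), such that for every c ≠ 0 every MGHD of F c has complete 𝓘⁺
and settles (summit sense) whenever it carries a remnant — escape from the threshold INTO the good
set at FIXED asymptotics (Christodoulou codimension ≥ 1 of the shell/extremal threshold inside a
fixed space of data): the far-out burial families that witnessed the old IsSmoothDataFamily form
(route review N2) are no longer -/
@[route_item "route-FinalStateConjecture-BurnettKineticRigidity"]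
def PhotonRegionThresholdCodim : Prop :=
  ∀ (X : Type) [TopologicalSpace X] [ChartedSpace Literature.Geometry.Lorentzian.E3 X] [IsManifold (𝓡 3) ∞ X] [T2Space X] [SecondCountableTopology X] [ConnectedSpace X], ∀ D ∈ Literature.Geometry.Lorentzian.admissibleVacuumData X, (∃ 𝒟 : Literature.Geometry.Lorentzian.VacuumCauchyDevelopment D, 𝒟.IsMaximal ∧ Summit.FinalStateConjecture.HasCompleteNullInfinity 𝒟.toCauchyDevelopment ∧ (∃ (M a ρ τ₀ : ℝ) (Ψ : ↥(Literature.Geometry.Lorentzian.Kerr.background M a).domain → 𝒟.carrier), 0 < M ∧ |a| ≤ M ∧ 𝒟.toSpacetime.IsLateChart (Literature.Geometry.Lorentzian.Kerr.background M a) (𝒟.metric.causalFuture 𝒟.timeOrientation (Set.range 𝒟.embed)) τ₀ Ψ ∧ ∀ R : ℝ, Filter.Tendsto (fun τ : ℝ ↦ Literature.Geometry.Lorentzian.supCkENorm (Subtype.val '' {x : ↥(Literature.Geometry.Lorentzian.Kerr.background M a).domain | (x : Literature.Geometry.Lorentzian.E4) 0 = τ ∧ ρ ≤ Literature.Geometry.Lorentzian.Kerr.radius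 a x ∧ Literature.Geometry.Lorentzian.Kerr.radius a x ≤ R}) 2 (𝒟.toSpacetime.deviationExtend (Literature.Geometry.Lorentzian.Kerr.background M a) Ψ)) Filter.atTop (nhds 0)) ∧ ¬ (∃ (O : Set 𝒟.carrier) (d : Literature.Geometry.Lorentzian.FinalStateDecomposition 𝒟.toSpacetime O 2), (∀ i, Literature.Geometry.Lorentzian.Kerr.IsSubextremal (d.mass i) (d.spin i)) ∧ O = Summit.FinalStateConjecture.exteriorOf 𝒟.toCauchyDevelopment d.charted ∧ Summit.FinalStateConjecture.RaysStayInClosure 𝒟.toCauchyDevelopment O ∧ Summit.FinalStateConjecture.HasExhaustiveCharts d ∧ Summit.FinalStateConjecture.IsFutureOriented d)) → ∃ (e : Literature.Geometry.Lorentzian.AFEnd X) (F : EuclideanSpace ℝ (Fin 1) → Literature.Geometry.Lorentzian.InitialDataSet (𝓡 3) X), Literature.Geometry.Lorentzian.InitialDataSet.IsTameDataFamily e 1 F ∧ Literature.Geometry.Lorentzian.InitialDataSet.IsImmersedAtZero 1 F ∧ F 0 = D ∧ Function.Injective F ∧ (∀ c, F c ∈ Literature.Geometry.Lorentzian.admissibleVacuumData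 X) ∧ ∀ c ≠ 0, ∀ 𝒟 : Literature.Geometry.Lorentzian.VacuumCauchyDevelopment (F c), 𝒟.IsMaximal → Summit.FinalStateConjecture.HasCompleteNullInfinity 𝒟.toCauchyDevelopment ∧ ((∃ (M a ρ τ₀ : ℝ) (Ψ : ↥(Literature.Geometry.Lorentzian.Kerr.background M a).domain → 𝒟.carrier), 0 < M ∧ |a| ≤ M ∧ 𝒟.toSpacetime.IsLateChart (Literature.Geometry.Lorentzian.Kerr.background M a) (𝒟.metric.causalFuture 𝒟.timeOrientation (Set.range 𝒟.embed)) τ₀ Ψ ∧ ∀ R : ℝ, Filter.Tendsto (fun τ : ℝ ↦ Literature.Geometry.Lorentzian.supCkENorm (Subtype.val '' {x : ↥(Literature.Geometry.Lorentzian.Kerr.background M a).domain | (x : Literature.Geometry.Lorentzian.E4) 0 = τ ∧ ρ ≤ Literature.Geometry.Lorentzian.Kerr.radius a x ∧ Literature.Geometry.Lorentzian.Kerr.radius a x ≤ R}) 2 (𝒟.toSpacetime.deviationExtend (Literature.Geometry.Lorentzian.Kerr.background M a) Ψ)) Filter.atTop (nhds 0)) → (∃ (O : Set 𝒟.carrier)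 (d : Literature.Geometry.Lorentzian.FinalStateDecomposition 𝒟.toSpacetime O 2), (∀ i, Literature.Geometry.Lorentzian.Kerr.IsSubextremal (d.mass i) (d.spin i)) ∧ O = Summit.FinalStateConjecture.exteriorOf 𝒟.toCauchyDevelopment d.charted ∧ Summit.FinalStateConjecture.RaysStayInClosure 𝒟.toCauchyDevelopment O ∧ Summit.FinalStateConjecture.HasExhaustiveCharts d ∧ Summit.FinalStateConjecture.IsFutureOriented d))

-- earlier CensorshipViolationCodim (stmt-FinalStateConjecture-9989, replaced 2026-08-16T23:13:53Z -> stmt-FinalStateConjecture-17294): retired by None — ∀ (X : Type) [TopologicalSpace X] [ChartedSpace Literature.Geometry.Lorentzian.E3 X] [IsManifold (𝓡 3) ∞ X] [T2Space X] [SecondCountableTopology X] [ConnectedSpace X], ∀ D ∈ Literature.Geometry.Lorentzian.admissibleVacuumData X, (∃ 𝒟 : Literature.Ge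
/-- item stmt-FinalStateConjecture-17294 · crux · rank 4 · open · by planner
why it might fail: WCC in tame-curve form + landing: RSR vacuum naked singularities (arXiv:1912.08478) may be stable under smooth admissible perturbations (Singh–Zheng: C^{1,α}-stability, scalar-field case); tameness excludes censoring by a giant far-out hole: instability is needed at fixed asymptotics.
sources: RodnianskiShlapentokhRothman2023, arXiv:2605.16235, Christodoulou1999instability, Christodoulou1999, DafermosRodnianski2008, Christodoulou2008
[crux] CENSORSHIP-VIOLATION CODIMENSION, TAME FORM (weak cosmic censorship in Christodoulou's
positive-codimension form inside a fixed space of data with fixed asymptotics, with escape into the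
good set; re-typed with the summit 2026-08-16, T2 p126844): for every admissible datum D possessing
an MGHD with INCOMPLETE future null infinity there are one asymptotically flat end e of X and an
injective one-parameter family of admissible data through D, tame on e (IsTameDataFamily) and
immersed at 0 (IsImmersedAtZero), all of whose other members have only MGHDs with complete 𝓘⁺ on
which remnant ⇒ settles (summit sense). Censoring the naked singularity inside a giant far-out hole
(a legal curve under the old typing, route review N2) is excluded by tameness (continuous mass on
the fixed end), so the content is naked-singularity instability at fixed asymptotics plus landing in
the good set. [difficulty: open-problem] -/
@[route_item "route-FinalStateConjecture-BurnettKineticRigidity"]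
def CensorshipViolationCodim : Prop :=
  ∀ (X : Type) [TopologicalSpace X] [ChartedSpace Literature.Geometry.Lorentzian.E3 X] [IsManifold (𝓡 3) ∞ X] [T2Space X] [SecondCountableTopology X] [ConnectedSpace X], ∀ D ∈ Literature.Geometry.Lorentzian.admissibleVacuumData X, (∃ 𝒟 : Literature.Geometry.Lorentzian.VacuumCauchyDevelopment D, 𝒟.IsMaximal ∧ ¬ Summit.FinalStateConjecture.HasCompleteNullInfinity 𝒟.toCauchyDevelopment) → ∃ (e : Literature.Geometry.Lorentzian.AFEnd X) (F : EuclideanSpace ℝ (Fin 1) → Literature.Geometry.Lorentzian.InitialDataSet (𝓡 3) X), Literature.Geometry.Lorentzian.InitialDataSet.IsTameDataFamily e 1 F ∧ Literature.Geometry.Lorentzian.InitialDataSet.IsImmersedAtZero 1 F ∧ F 0 = D ∧ Function.Injective F ∧ (∀ c, F c ∈ Literature.Geometry.Lorentzian.admissibleVacuumData X) ∧ ∀ c ≠ 0, ∀ 𝒟 : Literature.Geometry.Lorentzian.VacuumCauchyDevelopment (F c), 𝒟.IsMaximal → Summit.FinalStateConjecture.HasCompleteNullInfinity 𝒟.toCauchyDevelopment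 ∧ ((∃ (M a ρ τ₀ : ℝ) (Ψ : ↥(Literature.Geometry.Lorentzian.Kerr.background M a).domain → 𝒟.carrier), 0 < M ∧ |a| ≤ M ∧ 𝒟.toSpacetime.IsLateChart (Literature.Geometry.Lorentzian.Kerr.background M a) (𝒟.metric.causalFuture 𝒟.timeOrientation (Set.range 𝒟.embed)) τ₀ Ψ ∧ ∀ R : ℝ, Filter.Tendsto (fun τ : ℝ ↦ Literature.Geometry.Lorentzian.supCkENorm (Subtype.val '' {x : ↥(Literature.Geometry.Lorentzian.Kerr.background M a).domain | (x : Literature.Geometry.Lorentzian.E4) 0 = τ ∧ ρ ≤ Literature.Geometry.Lorentzian.Kerr.radius a x ∧ Literature.Geometry.Lorentzian.Kerr.radius a x ≤ R}) 2 (𝒟.toSpacetime.deviationExtend (Literature.Geometry.Lorentzian.Kerr.background M a) Ψ)) Filter.atTop (nhds 0)) → (∃ (O : Set 𝒟.carrier) (d : Literature.Geometry.Lorentzian.FinalStateDecomposition 𝒟.toSpacetime O 2), (∀ i, Literature.Geometry.Lorentzian.Kerr.IsSubextremal (d.mass i) (d.spin i)) ∧ O = Summit.FinalStateConjecture.exteriorOf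 𝒟.toCauchyDevelopment d.charted ∧ Summit.FinalStateConjecture.RaysStayInClosure 𝒟.toCauchyDevelopment O ∧ Summit.FinalStateConjecture.HasExhaustiveCharts d ∧ Summit.FinalStateConjecture.IsFutureOriented d))

-- earlier LateTimeBurnettIdentification (stmt-FinalStateConjecture-14235, replaced 2026-08-16T03:20:07Z -> stmt-FinalStateConjecture-14378): retired by None — ∀ (𝓢 : Literature.Geometry.Lorentzian.Spacetime.{0} 4), (∀ [𝓢.metric.toPseudoRiemannianMetric.HasLeviCivita], 𝓢.metric.toPseudoRiemannianMetric.IsRicciFlat) → ∀ (M a τ₀ L Λ C : ℝ) (B : Literature.Geometry.Lorentzian.ModelBackground), B = Liter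
/-- item stmt-FinalStateConjecture-14378 · crux · rank 6 · open · by planner
why it might fail: HL Thm 1.5 needs a C∞ limit g₀, bounded U, a frequency scale (|∂²g_n| ≲ λ_n⁻¹; the Vlasov part (4) without it is avowedly open, Rem 1.3) and a gauge RATE |H_n−H₀| ≲ λ_n^η; late-time limits are Lipschitz (thin shells), T2 gives H-convergence without rate, slabs are unbounded.
sources: arXiv:2403.03470, arXiv:1907.10743, arXiv:2404.07659, Burnett1989, arXiv:2402.17530, arXiv:2009.08968
[crux] LATE-TIME BURNETT IDENTIFICATION (repaired restatement of LateTimeBurnettCompactness after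
refuter rattack-9999, 2026-08-16: +T1 uniform non-degeneracy, +T2 wave-gauge control, conclusion
re-typed at chart level for Lipschitz limits (T3); the soft compactness half of (a) is split off as
support LateTimeBurnettPrecompactness, the LaSalle leg (b) with the scope/bookkeeping repairs T4-T5
as the informal sibling OmegaLimitsNonRadiating, leg (c) is Hale bookkeeping and dropped). SETTING:
(M,g) a smooth time-oriented VACUUM spacetime, Ψ a smooth map of the Kerr-Schild chart domain of
Kerr.background(M,a) into M, slabs S_L = {τ₀ < t* < τ₀+L}, translates g_T = (Ψ^*g)(· + T∂₀).
HYPOTHESES on {t* > τ₀}: (H0) sup_{T≥0} ‖g_T‖_{C¹(S_L)} < ∞ (HasUniformBurnettBounds; Burnett's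
hypothesis, HL Rem 1.3: no frequency scale, no ∂² bound); (T1) UNIFORM NON-DEGENERACY √|det Ψ^*g| ≥
Λ⁻¹ and (Ψ^*g)^{00} ≤ −Λ⁻¹ (MetricCoord.volDensity / ginv: the chart time t* is a uniformly timelike
COVECTOR, i.e. the slices are uniformly spacelike, while ∂₀ itself may go null/spacelike as for
Kerr–Schild t* in the ergoregion and at the horizon — so horizon-penetrating KS charts ARE
admissible (det g_KS = −1, g_KS -/
@[route_item "route-FinalStateConjecture-BurnettKineticRigidity"]
def LateTimeBurnettIdentification : Prop :=
  ∀ (𝓢 : Literature.Geometry.Lorentzian.Spacetime.{0} 4), (∀ [𝓢.metric.toPseudoRiemannianMetric.HasLeviCivita], 𝓢.metric.toPseudoRiemannianMetric.IsRicciFlat) → ∀ (M a τ₀ L Λ C : ℝ) (B : Literature.Geometry.Lorentzian.ModelBackground), B = Literature.Geometry.Lorentzian.Kerr.background M a → ∀ (Ψ : ↥B.domain → 𝓢.carrier) (S : Set Literature.Geometry.Lorentzian.E4) (G : Literature.Geometry.Lorentzian.E4 → Literature.Geometry.Lorentzian.E4 →L[ℝ] Literature.Geometry.Lorentzian.E4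 →L[ℝ] ℝ) (b : Module.Basis (Fin 4) ℝ Literature.Geometry.Lorentzian.E4), S = Subtype.val '' B.timeSlabIoo τ₀ L → G = 𝓢.chartMetricExtend B Ψ → b = (EuclideanSpace.basisFun (Fin 4) ℝ).toBasis → 0 < L → 0 < Λ → ContMDiff 𝓘(ℝ, Literature.Geometry.Lorentzian.E4) (𝓡 4) ∞ Ψ → 𝓢.HasUniformBurnettBounds B Ψ τ₀ L → (∀ x ∈ B.lateRegion τ₀, Λ⁻¹ ≤ Literature.Geometry.Lorentzian.MetricCoord.volDensity G x.1 ∧ Literature.Geometry.Lorentzian.MetricCoord.ginv G b x.1 0 0 ≤ -Λ⁻¹ ∧ ∀ k, |Literature.Geometry.Lorentzian.MetricCoord.waveGauge G b x.1 k| ≤ C ∧ ‖fderiv ℝ (fun y ↦ Literature.Geometry.Lorentzian.MetricCoord.waveGauge G b y k) x.1‖ ≤ C) → ∀ (T : ℕ → ℝ) (g : Literature.Geometry.Lorentzian.E4 → Literature.Geometry.Lorentzian.E4 →L[ℝ] Literature.Geometry.Lorentzian.E4 →L[ℝ] ℝ), Tendsto T atTop atTop → Literature.Geometry.Lorentzian.BurnettConverges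 S (fun n ↦ 𝓢.translatedChartMetric B Ψ (T n)) g → ∀ (Γ : Literature.Geometry.Lorentzian.E4 → Literature.Geometry.Lorentzian.E4 →L[ℝ] Literature.Geometry.Lorentzian.E4 →L[ℝ] Literature.Geometry.Lorentzian.E4) (P : Literature.Geometry.Lorentzian.E4 → Literature.Geometry.Lorentzian.E4 → ℝ), Γ = Literature.Geometry.Lorentzian.MetricCoord.chrAt g → P = (fun x ζ ↦ innerSL ℝ ζ (Literature.Geometry.Lorentzian.MetricCoord.sharpAt g x (innerSL ℝ ζ))) → ∃ φ : ℕ → ℕ, StrictMono φ ∧ ∃ μ : Measure (Literature.Geometry.Lorentzian.E4 × ↥(Metric.sphere (0 : Literature.Geometry.Lorentzian.E4) 1)), Literature.Geometry.Lorentzian.IsBurnettDefectDatum S (fun n ↦ 𝓢.translatedChartMetric B Ψ (T (φ n))) g μ ∧ μ {p | P p.1 p.2.1 ≠ 0} = 0 ∧ (∀ (ψ w : Literature.Geometry.Lorentzian.E4 → ℝ), ContDiff ℝ ∞ ψ → HasCompactSupport ψ → tsupport ψ ⊆ S → w = (fun y ↦ ψ y * Literature.Geometry.Lorentzian.MetricCoord.volDensity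 g y) → ∀ Y Z : Literature.Geometry.Lorentzian.E4, ∫ x, (-(fderiv ℝ w x (Γ x Y Z)) + fderiv ℝ w x Y * LinearMap.trace ℝ _ ((Γ x).flip Z).toLinearMap + w x * (LinearMap.trace ℝ _ ((Γ x).flip (Γ x Y Z)).toLinearMap - LinearMap.trace ℝ _ ((Γ x Y).comp ((Γ x).flip Z)).toLinearMap)) = Literature.Geometry.Lorentzian.cosphereSecondMoment μ ψ Y Z) ∧ (ContDiffOn ℝ 1 g S → ∀ ã : Literature.Geometry.Lorentzian.E4 → Literature.Geometry.Lorentzian.E4 → ℝ, ContDiffOn ℝ ∞ (fun q : Literature.Geometry.Lorentzian.E4 × Literature.Geometry.Lorentzian.E4 ↦ ã q.1 q.2) {q | q.2 ≠ 0} → (∀ x ξ, ∀ c : ℝ, 0 < c → ã x (c • ξ) = c * ã x ξ) → (∃ K ⊆ S, IsCompact K ∧ ∀ x ∉ K, ∀ ξ, ã x ξ = 0) → ∫ p, (∑ i : Fin 4, (fderiv ℝ (P p.1) p.2.1 (EuclideanSpace.single i 1) * fderiv ℝ (fun y ↦ ã y p.2.1) p.1 (EuclideanSpace.single i 1) - fderiv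 ℝ (fun y ↦ P y p.2.1) p.1 (EuclideanSpace.single i 1) * fderiv ℝ (ã p.1) p.2.1 (EuclideanSpace.single i 1))) ∂μ = 0)

-- earlier MGHDExistence (stmt-FinalStateConjecture-9990, replaced 2026-08-16T23:49:46Z -> stmt-FinalStateConjecture-9937): open — ∀ (X : Type) [TopologicalSpace X] [ChartedSpace Literature.Geometry.Lorentzian.E3 X] [IsManifold (𝓡 3) ∞ X] [T2Space X] [SecondCountableTopology X] [ConnectedSpace X], ∀ D ∈ Literature.Geometry.Lorentzian.admissibleVacuumData X, ∃ 𝒟 : Literature.Geometry.Lorentzian.Vacuum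
/-- item stmt-FinalStateConjecture-9937 · crux · rank 9 · open · by planner
why it might fail: Known in print (CBG 1969 Thm 3 = unproved XL tree fact choquetBruhat_geroch_exists_mghd_cauchy) but typing-exposed: IsMaximal makes EVERY typed VacuumCauchyDevelopment.{0} of D embed ι-compatibly into one 𝒟; a rogue typed development falsifies it (1st render over VacuumDevelopment refuted: isEmpty).
sources: ChoquetBruhatGeroch1969CMP, Sbierski2016AHP, Ringstrom2009, Literature.Geometry.Lorentzian.choquetBruhat_geroch_exists_mghd_cauchy, Literature.Geometry.Lorentzian.VacuumDevelopment.isEmpty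
[support] every admissible datum has a maximal globally hyperbolic vacuum development, stated over
the repaired structure `VacuumCauchyDevelopment` (the corrected form of the deprecated
`choquetBruhat_geroch_exists_mghd`, recorded in `CauchyProblemExistenceDefect`);
Choquet-Bruhat–Geroch 1969 Thm. 3, Sbierski 2016 Thm. 2.6. Known theorem; large formalisation;
shared by every route of this summit. [difficulty: XL] -/
@[route_item "route-FinalStateConjecture-BurnettKineticRigidity"]
def MGHDExistence : Prop :=
  ∀ (X : Type) [TopologicalSpace X] [ChartedSpace Literature.Geometry.Lorentzian.E3 X] [IsManifold (𝓡 3) ((⊤ : ℕ∞) : WithTop ℕ∞) X] [T2Space X] [SecondCountableTopology X] [ConnectedSpace X], ∀ D ∈ Literature.Geometry.Lorentzian.admissibleVacuumData X, ∃ 𝒟 : Literature.Geometry.Lorentzian.VacuumCauchyDevelopment D, 𝒟.IsMaximal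

-- item stmt-FinalStateConjecture-9998 · support · rank 5 · open · by planner — informal only, no Lean statement yet:
--   [crux] KINETIC RIGIDITY FOR EINSTEIN–MASSLESS-VLASOV (card burnett-limit-photons-kinetic-rigidity
--   H3, corrected by the novelty audit; the Liouville theorem behind SettlesOutsidePhotonRegions,
--   untyped until the definition requests EinsteinMasslessVlasovMeasure and IPlusRegular land): classify
--   the NON-RADIATING (Bondi news ≡ 0 for all retarded times u ∈ ℝ), asymptotically flat solutions (g,
--   μ) of the Einstein–massless-Vlasov system in which μ is a non-negative Radon measure on the bundle
--   of future-directed null covectors, invariant under the geodesic flow (transport) and supported on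
--   null geodes

-- item stmt-FinalStateConjecture-14450 · support · rank 7 · open · by planner — informal only, no Lean statement yet:
--   [crux] OMEGA-LIMITS ARE NON-RADIATING (LaSalle leg (b) of the old LateTimeBurnettCompactness,
--   carrying refuter rattack-9999's repairs T4-T5; informal until a flux notion for Lipschitz
--   chart-level limits exists, definition request NonRadiatingBurnettLimit). SETTING: 𝒟 a maximal vacuum
--   Cauchy development of admissible data with complete scri+; Ψ a late EMBEDDING on
--   Kerr.background(M,a) (IsLateEmbedding, T4, not merely IsLateChart: Ψ{t* > τ₀} must cover the late
--   part of the self-determined exterior O = J⁺(ιX) ∩ I⁻(Ψ{t* > τ₀}), i.e. O minus the image lies in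
--   J⁻(Ψ{t* = τ₀}); so the chart can neithe

/-- item stmt-FinalStateConjecture-14100 · support · rank 9 · closed · proved by Summit.FinalStateConjecture.FinalStateConjecture.Theorems.lateTimeBurnettPrecompactness_proof @ b26a35cbb98e (prover) · by planner
sources: Hale1980, arXiv:2403.03470, Burnett1989
[support] SOFT LATE-TIME BURNETT PRECOMPACTNESS (split off LateTimeBurnettCompactness per refuter
rattack-9999; Arzelà–Ascoli + diagonal extraction, no field equations): for a spacetime 𝓢 and a
chart Ψ of the Kerr–Schild domain of Kerr.background(M,a) whose pulled-back components are C¹ on the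
(open) domain, uniform C¹ bounds of the translates g_T = (Ψ^*g)(· + T∂₀), T ≥ 0, on the slab S_L =
{τ₀ < t* < τ₀+L} (HasUniformBurnettBounds) imply that every sequence T_n → ∞ has a subsequence along
which g_{T_n} Burnett-converges on S_L (locally uniformly with equi-Lipschitz bounds,
BurnettConverges) to some g_∞; in particular the late-time Burnett ω-limit set
lateTimeBurnettOmegaLimitSet is nonempty (Sketch.lean: example proved from this item). Mean-value
inequality on balls of the open slab turns the iteratedFDeriv bound into equi-Lipschitz bounds;
Arzelà–Ascoli on an exhaustion by compact balls + a diagonal subsequence gives locally uniform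
convergence. [difficulty: M] [sources: Hale1980 Ch. I §8, arXiv:2403.03470 Rem. 1.3, Burnett1989] -/
@[route_item "route-FinalStateConjecture-BurnettKineticRigidity"]
def LateTimeBurnettPrecompactness : Prop :=
  ∀ (𝓢 : Literature.Geometry.Lorentzian.Spacetime.{0} 4) (M a τ₀ L : ℝ) (Ψ : ↥(Literature.Geometry.Lorentzian.Kerr.background M a).domain → 𝓢.carrier), ContDiffOn ℝ 1 (𝓢.chartMetricExtend (Literature.Geometry.Lorentzian.Kerr.background M a) Ψ) ((Literature.Geometry.Lorentzian.Kerr.background M a).domain : Set Literature.Geometry.Lorentzian.E4) → 𝓢.HasUniformBurnettBounds (Literature.Geometry.Lorentzian.Kerr.background M a) Ψ τ₀ L → ∀ (T : ℕ → ℝ), Tendsto T atTop atTop → ∃ φ : ℕ → ℕ, StrictMono φ ∧ ∃ g : Literature.Geometry.Lorentzian.E4 → Literature.Geometry.Lorentzian.E4 →L[ℝ] Literature.Geometry.Lorentzian.E4 →L[ℝ] ℝ, Literature.Geometry.Lorentzian.BurnettConverges (Subtype.val '' (Literature.Geometry.Lorentzian.Kerr.background M a).timeSlabIoo τ₀ L)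 (fun n ↦ 𝓢.translatedChartMetric (Literature.Geometry.Lorentzian.Kerr.background M a) Ψ (T (φ n))) g

-- `LateTimeBurnettPrecompactness` holds: proved by `Summit.FinalStateConjecture.FinalStateConjecture.Theorems.lateTimeBurnettPrecompactness_proof` @ b26a35cbb98e (its module imports this route file, so no `_holds` link can be stated here).

/-- item stmt-FinalStateConjecture-9991 · assembly · rank 1 · open · by planner
sources: Christodoulou1999, DafermosLuk2017
[assembly] SettlesOutsidePhotonRegions → PhotonRegionThresholdCodim → CensorshipViolationCodim →
MGHDExistence → FinalStateConjecture. -/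
@[route_item "route-FinalStateConjecture-BurnettKineticRigidity"]
def Assembly : Prop :=
  SettlesOutsidePhotonRegions → PhotonRegionThresholdCodim → CensorshipViolationCodim → MGHDExistence → _root_.FinalStateConjecture

-- records of items no longer active in this route (dropped / restated):
-- earlier LateTimeBurnettCompactness (stmt-FinalStateConjecture-9999, replaced 2026-08-16T03:09:43Z -> stmt-FinalStateConjecture-14235): retired by None — [crux] LATE-TIME BURNETT COMPACTNESS AND IDENTIFICATION (card burnett-limit-photons-kinetic-rigidity H1+H2 + the LaSalle step; the compactness engine behind SettlesOutsidePhotonRegions, untyped until the definition requests BurnettConvergence and 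

/-! D-0027 §2.1 — DECIDING THEOREM (planner-authored via `route open/edit --closes-file`; by planner-rbadge-FinalStateConjecture-BurnettKin-eda767bc-0 2026-08-16T23:49:46Z):
its hypotheses are this route's items and its conclusion the sub-problem Statement (glue_lint), and it elaborates with this file. -/

@[closes "route-FinalStateConjecture-BurnettKineticRigidity"] theorem closes (hA : SettlesOutsidePhotonRegions) (hS : PhotonRegionThresholdCodim)
    (hW : CensorshipViolationCodim) (hE : MGHDExistence) :
    _root_.FinalStateConjecture := by
  intro X _ _ _ _ _ _ d hd
  obtain ⟨hdA, hnP⟩ := hd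
  -- an escaping TAME family exists (re-type T2, p126844: one fixed end `e`, immersed at `0`)
  have hesc : ∃ (e : Literature.Geometry.Lorentzian.AFEnd X) (F : EuclideanSpace ℝ (Fin 1) → Literature.Geometry.Lorentzian.InitialDataSet (𝓡 3) X), Literature.Geometry.Lorentzian.InitialDataSet.IsTameDataFamily e 1 F ∧ Literature.Geometry.Lorentzian.InitialDataSet.IsImmersedAtZero 1 F ∧ F 0 = d ∧ Function.Injective F ∧ (∀ c, F c ∈ Literature.Geometry.Lorentzian.admissibleVacuumData X) ∧ ∀ c ≠ 0, ∀ 𝒟 : Literature.Geometry.Lorentzian.VacuumCauchyDevelopment (F c), 𝒟.IsMaximal → Summit.FinalStateConjecture.HasCompleteNullInfinity 𝒟.toCauchyDevelopment ∧ ((∃ (M a ρ τ₀ : ℝ) (Ψ : ↥(Literature.Geometry.Lorentzian.Kerr.background M a).domain → 𝒟.carrier), 0 < M ∧ |a| ≤ M ∧ 𝒟.toSpacetime.IsLateChart (Literature.Geometry.Lorentzian.Kerr.background M a) (𝒟.metric.causalFuture 𝒟.timeOrientation (Set.range 𝒟.embed)) τ₀ Ψ ∧ ∀ R : ℝ, Filter.Tendsto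 (fun τ : ℝ ↦ Literature.Geometry.Lorentzian.supCkENorm (Subtype.val '' {x : ↥(Literature.Geometry.Lorentzian.Kerr.background M a).domain | (x : Literature.Geometry.Lorentzian.E4) 0 = τ ∧ ρ ≤ Literature.Geometry.Lorentzian.Kerr.radius a x ∧ Literature.Geometry.Lorentzian.Kerr.radius a x ≤ R}) 2 (𝒟.toSpacetime.deviationExtend (Literature.Geometry.Lorentzian.Kerr.background M a) Ψ)) Filter.atTop (nhds 0)) → (∃ (O : Set 𝒟.carrier) (d : Literature.Geometry.Lorentzian.FinalStateDecomposition 𝒟.toSpacetime O 2), (∀ i, Literature.Geometry.Lorentzian.Kerr.IsSubextremal (d.mass i) (d.spin i)) ∧ O = Summit.FinalStateConjecture.exteriorOf 𝒟.toCauchyDevelopment d.charted ∧ Summit.FinalStateConjecture.RaysStayInClosure 𝒟.toCauchyDevelopment O ∧ Summit.FinalStateConjecture.HasExhaustiveCharts d ∧ Summit.FinalStateConjecture.IsFutureOriented d)) := by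
    by_cases hc : ∃ 𝒟 : Literature.Geometry.Lorentzian.VacuumCauchyDevelopment d, 𝒟.IsMaximal ∧
        ¬ Summit.FinalStateConjecture.HasCompleteNullInfinity 𝒟.toCauchyDevelopment
    · exact hW X d hdA hc
    · have hc' : ∀ 𝒟 : Literature.Geometry.Lorentzian.VacuumCauchyDevelopment d, 𝒟.IsMaximal →
          Summit.FinalStateConjecture.HasCompleteNullInfinity 𝒟.toCauchyDevelopment := by
        intro 𝒟 h𝒟
        by_contra hn
        exact hc ⟨𝒟, h𝒟, hn⟩
      apply hS X d hdA
      by_contra hno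
      apply hnP
      refine ⟨hE X d hdA, fun 𝒟 h𝒟 ↦ ⟨hc' 𝒟 h𝒟, ?_⟩⟩
      rcases hA X d hdA 𝒟 h𝒟 (hc' 𝒟 h𝒟) with hset | hrem
      · exact hset
      · by_contra hns
        exact hno ⟨𝒟, h𝒟, hc' 𝒟 h𝒟, hrem, hns⟩
  obtain ⟨e, F, hF, hI, h0, hinj, hadm, hgood⟩ := hesc
  refine ⟨e, F, hF, hI, h0, hinj, hadm, fun c hc hmem ↦ ?_⟩
  obtain ⟨-, hnP'⟩ := hmem
  apply hnP'
  refine ⟨hE X (F c) (hadm c), fun 𝒟 h𝒟 ↦ ?_⟩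
  obtain ⟨hcomp, himp⟩ := hgood c hc 𝒟 h𝒟
  refine ⟨hcomp, ?_⟩
  rcases hA X (F c) (hadm c) 𝒟 h𝒟 hcomp with hset | hrem
  · exact hset
  · exact himp hrem

end Summit.FinalStateConjecture.FinalStateConjecture.Theses.BurnettKineticRigidity
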